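import Literature.NumberTheory.EllipticCurves.CyclotomicIwasawaMainTheoremIrreducible
import Literature.NumberTheory.EllipticCurves.BSDSelmerPConverseSerreProofs
import HarnessLib

/-!
# Burungale–Castella–Skinner 2025, Thm. 1.1.2 (b): Mazur's characteristic-ideal identity
# `ch_Λ X(E/ℚ_∞) = (L_p(E/ℚ))` IN `Λ` (integral equality) for irreducible `E[p]` WITHOUT the
# auxiliary prime — special case "(im) ⇐ `ρ_{E,p}` surjective" (named fact), and the bsd.S21-shaped
# assembly (theorems)

Topic `Literature/NumberTheory/EllipticCurves`; sibling of
`CyclotomicIwasawaMainTheoremIrreducible.lean`, whose named fact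
`burungale_castella_skinner_charIdeal_eq_padicLFunction` is part **(a)** of the same theorem
(the RATIONAL equality `ch_Λ X(E/ℚ_∞) = (L_p(E/ℚ))` in `Λ ⊗ ℚ_p`; its `TODO(general form)`
records that part (b) was left untyped for want of tree vocabulary for the hypothesis (im)).
Written for the rank-2 `Ш[p^∞]` cell `b2b-bsdr2sha` (run/shared/lean/b2b/bsd-rank2-sha/), whose
exact-order rows use the INTEGRAL identity; HONEST FRAMING: this file TYPES one published theorem
(a special case of it) as a named fact and proves two bookkeeping corollaries; it asserts nothing
(no `_holds`), books no census row and makes no claim on BSD.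

## Source, as printed (A. Burungale, F. Castella, C. Skinner, Int. Math. Res. Not. IMRN 2025,
## no. 8, rnaf082 = arXiv:2405.00270v2, read on the held text `paper:arxiv-2405.00270`, p. 2,
## ll. 2–32; "Conj. 1.1.1" there = Mazur 1972: `X^ord(E/ℚ_∞)` is torsion and
## `ch_Λ(X^ord(E/ℚ_∞)) = (L_p(E/ℚ))` as ideals of `Λ`)

"Note that implicit in [Conj.] 1.1.1 is the integrality statement `L_p(E/ℚ) ∈ Λ`; this is most
well-understood under the assumption that `p` is odd and `E[p]` is an irreducible `G_ℚ`-module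
(irr_ℚ) (see [GV00, Prop. 3.1]) […] Let `T` be the `p`-adic Tate module of `E`. In [Kat04], Kato
proved the `Λ`-torsionness of `X^ord(E/ℚ_∞)` and the inclusion `p^c · L_p(E/ℚ) ∈ ch_Λ(X^ord(E/ℚ_∞))`
for some `c ≥ 0`, with `c = 0` when `T` has large image. […] Assuming further that there exists a
prime `q ‖ N` such that `E[p]` is ramified at `q`, (mult) the converse divisibility, and hence
[Conj.] 1.1.1 was proved by Skinner–Urban [SU14]. […] Our main result towards [Conj.] 1.1.1
removes the hypothesis (mult):
**Theorem 1.1.2.** Let `E` be an elliptic curve defined over `ℚ` and `p` a prime of good ordinary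
reduction for `E`. (a) If `p > 3` satisfies (irr_ℚ), then `X^ord(E/ℚ_∞)` is `Λ`-torsion, with
`ch_Λ(X^ord(E/ℚ_∞)) = (L_p(E/ℚ))` in `Λ ⊗ ℚ_p`. (b) If in addition there exists an element
`σ ∈ G_{ℚ(μ_{p^∞})}` such that `T/(σ − 1)T ≃ ℤ_p`, (im) then the equality holds in `Λ`, and hence
[Conj.] 1.1.1 holds.
Remark 1.1.3. (i) For non-CM curves the condition (im) holds for all sufficiently large primes `p`
by Serre's open image theorem [Ser72]. In fact, it is expected that `p ≥ 37` suffices. (ii) The only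
prior result towards [Conj.] 1.1.1 without assuming the hypothesis (mult) is due to Wan [Wan15]
[…] However, it is conditional on a `p`-integral comparison of certain automorphic periods, which
still remains open. Our proof of Theorem 1.1.2 relies on a main result of [Wan15] but sidesteps the
period comparison. (iii) Under the condition (irr_ℚ), the essential case excluded by Theorem 1.1.2
is that of (residually) dihedral primes `p`."
Here (p. 1) `Λ = ℤ_p⟦Γ⟧`, `Γ = Gal(ℚ_∞/ℚ)`, `X^ord(E/ℚ_∞) = Hom_{ℤ_p}(Sel_{p^∞}(E/ℚ_∞), ℚ_p/ℤ_p)`, and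
`L_p(E/ℚ) ∈ Λ ⊗ ℚ_p` is "the `p`-adic `L`-function attached to `E` by Mazur–Swinnerton-Dyer
[MSD74]". Proof of (b) (p. 10, ll. 69–99): the four-fold divisibility (5.3) holds in `Λ`; "by
[Kat04, Thm. 17.4] we have the divisibility `(L_p(g/ℚ)) ⊂ ch_Λ(X^ord(g/ℚ_∞))` (5.4) in `Λ` if
hypothesis (im) holds, and in `Λ ⊗ ℚ_p` otherwise […] a proper divisibility in (5.4) would
contradict (5.3)".

## What is typed, and why it is the printed theorem or weaker (never stronger)

* THE SPECIAL CASE (im) ⇐ "`ρ_{E,p} : G_ℚ → Aut(T_pE) ≅ GL₂(ℤ_p)` is surjective", spelled as in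
  bsd.S20/S21 (`PAdicBSD.lean`): `∀ n, W.HasSurjectiveModNGaloisRep (p^n)`. Indeed if `ρ_{E,p}` is
  onto `GL₂(ℤ_p)` then, `det ρ_{E,p} = χ_cyc` cutting out `ℚ(μ_{p^∞})`, `ρ_{E,p}(G_{ℚ(μ_{p^∞})}) =
  SL₂(ℤ_p) ∋ σ = (1 1; 0 1)`, and `(σ − 1)T = ℤ_p e₁`, so `T/(σ − 1)T ≃ ℤ_p`: (im) holds. (Under this
  hypothesis Kato's own integral condition (12.5.2) — the image of `G_{ℚ(ζ_{p^∞})}` contains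
  `SL₂(ℤ_p)` — holds as well, `Kato2004.imageContainsSL2_iff_forall_hasSurjectiveModNGaloisRep`, so
  the step (5.4) of the printed proof is Kato's Thm. 17.4 (3) verbatim in this case.) The general
  hypothesis (im) has no tree vocabulary yet:
  `-- TODO(general form): hypothesis (im) "∃ σ ∈ G_{ℚ(μ_{p^∞})}, T_pE/(σ-1)T_pE ≃ ℤ_p" in place of`
  `-- p-adic surjectivity; and the main text's weight-two newform version (§5, Prop. 5.2.1).`
* `5 ≤ p` is the printed "`p > 3`"; good ordinary = `HasGoodReductionAtPrime p ∧ ¬ p ∣ a_p` (for the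
  globally minimal `W`); (irr_ℚ) = `HasIrreducibleModPGaloisRep p`; the cyclotomic datum
  (`κ.IsCyclotomic`, `κ.IsTopGenerator γ`, `IsCyclotomicVariable p γ`), the newform `f` of `E`
  (`IsNewformOf W f`), `X = D.X` for a dual datum `D : W.SelmerDualData κ γ` with `ch_Λ X = D.charIdeal`
  and `L_p(E, T) = padicLFunction f (unitRoot W p)` are EXACTLY those of part (a)'s named fact and of
  bsd.S21 — see their docstrings for the identifications (`D.toDual`; "`Λ ⊗ ℚ_p` versus `ℚ_p⟦T⟧`").
* "the equality holds in `Λ`" is rendered as clause 3 of bsd.S21 verbatim: `∃ g ∈ Λ` with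
  `ι g = padicLFunction f α` and `D.charIdeal = (g)` (`ι = iwasawaToPowerSeries p : Λ ↪ ℚ_p⟦T⟧`).
  B–C–S's `L_p(E/ℚ)` (Néron period `Ω_E`) is `ϖ · padicLFunction f α` with `ϖ · Ω_E = Ω⁺_f`
  (`PAdicBSD.lean`, Normalisations); `ϖ ∈ ℚˣ` is a `p`-adic unit at an odd good prime `p` when `E[p]`
  is irreducible (no rational `p`-isogeny in the class, Manin constant prime to `p` — loc. cit. and
  the prelude's `padicLFunction_mem_integral`), so the two principal ideals of `Λ` coincide and the
  rendering is the printed equality of ideals in `Λ` — the same reading as bsd.S21 clause 3, which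
  carries the extra hypothesis (ram) and `3 ≤ p`. Binder for binder, the fact below is bsd.S21 with
  `haux` (= (mult)/(ram)) DROPPED, `3 ≤ p` sharpened to `5 ≤ p`, the surjectivity hypothesis of
  clause 3 moved among the binders, and conclusion = clauses 1 and 3 of bsd.S21.

## For the census (cell b2b-bsdr2sha)

At `p ≥ 5` a row with `GoodOrd ∧ Irr ∧ Surj` but NO (ram) prime (`¬ Ram W p`: no multiplicative
`ℓ ≠ p` with `p ∤ v_ℓ(Δ_min)`) is outside Skinner–Urban's Thm. 3.6.9 as printed; by Thm. 1.1.2 (b)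
it still has the INTEGRAL identity `ch_Λ X = (L_p)`, hence (with Perrin-Riou–Schneider) the EXACT
order of `Ш(E/ℚ)[p^∞]`, exactly as in the (ram) case. `charIdeal_triple_of_burungale_castella_skinner`
below delivers the conclusion of bsd.S21 (all three clauses) from parts (a) and (b), so a row theorem
written against bsd.S21 transposes by replacing that hypothesis and `Ram` with the two B–C–S facts;
`…_of_hasSurjectiveModNGaloisRep` takes mod-`p` surjectivity (Serre witnesses) instead of `p`-adic
surjectivity, via the tree theorem `serre_hasSurjectiveModNGaloisRep_pow_holds` (`p ≥ 5`).

## References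

* [BurungaleCastellaSkinner2025] A. Burungale, F. Castella, C. Skinner, Int. Math. Res. Not. IMRN
  2025, no. 8, rnaf082 (doi 10.1093/imrn/rnaf082) = arXiv:2405.00270v2: Thm. 1.1.2 and Rem. 1.1.3
  (p. 2), proof of Thm. 1.1.2 (p. 10).
* [Kato2004Asterisque] K. Kato, Astérisque 295 (2004), Thm. 17.4 (p. 273), (12.5.2) (p. 222).
* [SkinnerUrban2014] C. Skinner, E. Urban, Invent. Math. 195 (2014), Thm. 3.6.9 of the author
  version (p. 45) = Thm. 3.33 of the journal.
* [SerreAbelianLadic1968] J.-P. Serre, *Abelian `ℓ`-adic representations*, IV §3.4, Lemma 3.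
-/

namespace Literature.NumberTheory.EllipticCurves

open Literature.NumberTheory.EllipticCurves Literature.NumberTheory.EllipticCurves.ModularForms

/-- **Burungale–Castella–Skinner 2025, Thm. 1.1.2 (b) — Mazur's characteristic-ideal identity
`ch_Λ X(E/ℚ_∞) = (L_p(E, T))` IN `Λ` for irreducible `E[p]`, WITHOUT the auxiliary prime; special
case (im) ⇐ `ρ_{E,p}` surjective** (a THEOREM of the source: Int. Math. Res. Not. IMRN 2025, no. 8,
rnaf082 = arXiv:2405.00270v2, Thm. 1.1.2 (b), p. 2; proof p. 10, by base change from Wan's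
three-variable divisibility over a quartic CM field plus Kato's integral divisibility, Astérisque 295,
Thm. 17.4 (3)). Let `E/ℚ` have globally minimal model `W`, `p ≥ 5` (`hp`) a prime of good ordinary
reduction (`hgood`, `hord : p ∤ a_p`) with `E[p]` irreducible (`hirr`, (irr_ℚ)) and `ρ̄_{E,p^n}`
surjective for every `n` (`hsurj`; i.e. `ρ_{E,p}` onto `GL₂(ℤ_p)`, which implies B–C–S's (im):
`∃ σ ∈ G_{ℚ(μ_{p^∞})}` with `T_pE/(σ − 1)T_pE ≃ ℤ_p`, and Kato's (12.5.2)). Let `ℚ_∞/ℚ` be the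
cyclotomic `ℤ_p`-extension (`hκ`) with topological generator `γ` (`hγ`) matching the cyclotomic
variable (`hγ'`), `f` the newform of `E` (`hf`), `L_p(E, T) = padicLFunction f (unitRoot W p)` and
`X = X(E/ℚ_∞)` the Iwasawa module of `D` (`Λ = ℤ_p⟦T⟧`, `T = γ − 1`). Then `X` is `Λ`-torsion and
`ch_Λ X = (L_p(E, T))` in `Λ`: there is `g ∈ Λ` with `ι g = L_p(E, T)` and `ch_Λ X = Λ g`
(`ι = iwasawaToPowerSeries p`). As printed (Thm. 1.1.2, p. 2): "Let `E` be an elliptic curve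
defined over `ℚ` and `p` a prime of good ordinary reduction for `E`. (a) If `p > 3` satisfies
(irr_ℚ), then `X^ord(E/ℚ_∞)` is `Λ`-torsion, with `ch_Λ(X^ord(E/ℚ_∞)) = (L_p(E/ℚ))` in `Λ ⊗ ℚ_p`.
(b) If in addition there exists an element `σ ∈ G_{ℚ(μ_{p^∞})}` such that `T/(σ − 1)T ≃ ℤ_p`, (im)
then the equality holds in `Λ` […]." Part (a) is the sibling fact
`burungale_castella_skinner_charIdeal_eq_padicLFunction`; the binders and the rendering of
"equality in `Λ`" (B–C–S's `L_p(E/ℚ) = ϖ · padicLFunction f α`, `ϖ` a `p`-adic unit under (irr_ℚ))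
are those of bsd.S21 (`PAdicBSD.lean`) clause 3, with its hypothesis (ram) dropped and `3 ≤ p`
sharpened to `5 ≤ p` (module docstring). No `_holds` (Kato's Euler system, Wan's three-variable
divisibility over a quartic CM field and the Beilinson–Flach/Heegner inputs of §4 are not in the
tree); consumers take `(hBCS : burungale_castella_skinner_charIdeal_eq_padicLFunction_integral)`.
-- TODO(general form): hypothesis (im) in place of `∀ n, HasSurjectiveModNGaloisRep (p^n)`; the
-- weight-two newform version of §5 (Prop. 5.2.1).
[cite: BurungaleCastellaSkinner2025, Thm. 1.1.2 (b) (p. 2 of arXiv:2405.00270v2) and its proof (p. 10)] -/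
def burungale_castella_skinner_charIdeal_eq_padicLFunction_integral : Prop :=
  ∀ (W : WeierstrassCurve ℚ) [W.IsElliptic] [W.IsGloballyMinimal] (p : ℕ) [Fact p.Prime]
    (κ : ZpExtension ℚ p) (γ : Field.absoluteGaloisGroup ℚ)
    {N : ℕ} [NeZero N] (f : CuspForm (CongruenceSubgroup.Gamma0 N) 2)
    (_hp : 5 ≤ p) (_hgood : W.HasGoodReductionAtPrime p) (_hord : ¬ (p : ℤ) ∣ W.frobeniusTrace p)
    (_hirr : W.HasIrreducibleModPGaloisRep p)
    (_hsurj : ∀ n : ℕ, W.HasSurjectiveModNGaloisRep (p ^ n : ℕ))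
    (_hκ : κ.IsCyclotomic) (_hγ : κ.IsTopGenerator γ) (_hγ' : IsCyclotomicVariable p γ)
    (_hf : IsNewformOf W f) (D : W.SelmerDualData κ γ),
    D.IsTorsion ∧
      ∃ g : IwasawaAlgebra p,
        iwasawaToPowerSeries p g = padicLFunction f (unitRoot W p : ℚ_[p]) ∧
          D.charIdeal = Ideal.span {g}

/-- **The bsd.S21-shaped conclusion from Burungale–Castella–Skinner (a) + (b).** At `p ≥ 5` good
ordinary with `E[p]` irreducible — and NO auxiliary (ram) prime — parts (a) and (b) of B–C–S
Thm. 1.1.2 give, for every cyclotomic datum, exactly the three clauses of bsd.S21 (`PAdicBSD.lean`):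
`X` torsion; `ch_Λ X = (g)` with `ι g = p^k · L_p(E, T)`, `k ∈ ℤ`; and, if `ρ̄_{E,p^n}` is
surjective for all `n`, `ch_Λ X = (g)` with `ι g = L_p(E, T)`. (Drop-in for consumers of bsd.S21's
conclusion, e.g. the rank-2 cell's exact-order row theorems.)
[cite: BurungaleCastellaSkinner2025, Thm. 1.1.2 (a), (b) (p. 2)] -/
theorem charIdeal_triple_of_burungale_castella_skinner
    (ha : burungale_castella_skinner_charIdeal_eq_padicLFunction)
    (hb : burungale_castella_skinner_charIdeal_eq_padicLFunction_integral)
    (W : WeierstrassCurve ℚ) [W.IsElliptic] [W.IsGloballyMinimal] (p : ℕ) [Fact p.Prime]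
    (κ : ZpExtension ℚ p) (γ : Field.absoluteGaloisGroup ℚ)
    {N : ℕ} [NeZero N] (f : CuspForm (CongruenceSubgroup.Gamma0 N) 2)
    (hp : 5 ≤ p) (hgood : W.HasGoodReductionAtPrime p) (hord : ¬ (p : ℤ) ∣ W.frobeniusTrace p)
    (hirr : W.HasIrreducibleModPGaloisRep p)
    (hκ : κ.IsCyclotomic) (hγ : κ.IsTopGenerator γ) (hγ' : IsCyclotomicVariable p γ)
    (hf : IsNewformOf W f) (D : W.SelmerDualData κ γ) :
    D.IsTorsion ∧
      (∃ (g : IwasawaAlgebra p) (k : ℤ), D.charIdeal = Ideal.span {g} ∧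
        iwasawaToPowerSeries p g =
          PowerSeries.C ((p : ℚ_[p]) ^ k) * padicLFunction f (unitRoot W p : ℚ_[p])) ∧
      ((∀ n : ℕ, W.HasSurjectiveModNGaloisRep (p ^ n : ℕ)) →
        ∃ g : IwasawaAlgebra p,
          iwasawaToPowerSeries p g = padicLFunction f (unitRoot W p : ℚ_[p]) ∧
            D.charIdeal = Ideal.span {g}) := by
  obtain ⟨htors, hrat⟩ := ha W p κ γ f hp hgood hord hirr hκ hγ hγ' hf D
  exact ⟨htors, hrat, fun hsurj ↦ (hb W p κ γ f hp hgood hord hirr hsurj hκ hγ hγ' hf D).2⟩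

/-- **Part (b) from mod-`p` surjectivity** (the census's Serre-witness certificate): at `p ≥ 5`,
`ρ̄_{E,p}` onto `GL₂(𝔽_p)` already gives `ρ̄_{E,p^n}` onto for every `n` (Serre, *Abelian `ℓ`-adic
representations* IV §3.4 Lemma 3; tree theorem `serre_hasSurjectiveModNGaloisRep_pow_holds`), so
B–C–S Thm. 1.1.2 (b) applies: `X` is torsion and `ch_Λ X = (g)`, `ι g = L_p(E, T)`.
[cite: BurungaleCastellaSkinner2025, Thm. 1.1.2 (b) (p. 2)]
[cite: SerreAbelianLadic1968, Ch. IV §3.4, Lemma 3] -/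
theorem charIdeal_eq_padicLFunction_integral_of_hasSurjectiveModNGaloisRep
    (hb : burungale_castella_skinner_charIdeal_eq_padicLFunction_integral)
    (W : WeierstrassCurve ℚ) [W.IsElliptic] [W.IsGloballyMinimal] (p : ℕ) [Fact p.Prime]
    (κ : ZpExtension ℚ p) (γ : Field.absoluteGaloisGroup ℚ)
    {N : ℕ} [NeZero N] (f : CuspForm (CongruenceSubgroup.Gamma0 N) 2)
    (hp : 5 ≤ p) (hgood : W.HasGoodReductionAtPrime p) (hord : ¬ (p : ℤ) ∣ W.frobeniusTrace p)
    (hirr : W.HasIrreducibleModPGaloisRep p) (hsurj : W.HasSurjectiveModNGaloisRep p)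
    (hκ : κ.IsCyclotomic) (hγ : κ.IsTopGenerator γ) (hγ' : IsCyclotomicVariable p γ)
    (hf : IsNewformOf W f) (D : W.SelmerDualData κ γ) :
    D.IsTorsion ∧
      ∃ g : IwasawaAlgebra p,
        iwasawaToPowerSeries p g = padicLFunction f (unitRoot W p : ℚ_[p]) ∧
          D.charIdeal = Ideal.span {g} :=
  hb W p κ γ f hp hgood hord hirr (serre_hasSurjectiveModNGaloisRep_pow_holds W p hp hsurj)
    hκ hγ hγ' hf D

end Literature.NumberTheory.EllipticCurves
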